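import Literature.MathematicalPhysics.KineticTheory.DiPernaLionsApproxExpForm
import HarnessLib

/-!
# The approximate solutions as exponential (super)solutions in `[0, ∞]` form (CIP (3.36), (3.38))

Topic: MathematicalPhysics / KineticTheory. Infrastructure for the named fact (L12)
`diPernaLions_limit_expDuhamel` (Cercignani–Illner–Pulvirenti 1994 §5.3 Lemma 5.3.12), continuing
`DiPernaLionsApproxExpForm`: elementary properties of the coefficients `λ_δ`
(`truncatedCollisionFrequency`), `G_δ` (`truncatedGain`), `Λ♯` (`truncatedDampingExponent`) of
the truncated equation, and the exponential form of an approximate solution rewritten junk-free in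
`[0, ∞]` with the true gain integral `eGain`,
`f♯(t) = f(0) e^{-Λ♯(t)} + ∫₀ᵗ a♯(s) Q₊(f,f)♯(s) e^{-(Λ♯(t) - Λ♯(s))} ds`, `a = (1 + δ ∫ |f| dv)⁻¹`
(`IsDiPernaLionsApproximateSolution.ofReal_sharp_eq_lintegral`), from which the supersolution
inequality (3.38) of the proof of Lemma 5.3.12 (p. 158: "Now observe that from (3.36)
`fⁿ ≥ f₀ⁿ e^{-Fₙ} + T_{Fₙ}⁻¹ Q₊ⁿ(gₘⁿ, gₘⁿ)` (3.38)") follows for *every* sub-density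
`0 ≤ g ≤ f` and sub-kernel `0 ≤ b ≤ B` by monotonicity of the true gain integral
(`IsDiPernaLionsApproximateSolution.expSupersolution_of_le`, `eGain_mono`). Everything is proved;
theorems only.

* `truncatedCollisionFrequency_nonneg`, `truncatedGain_nonneg`, `truncatedGain_le_gainWith`,
  `truncatedCollisionFrequency_le`, `truncatedDampingExponent_nonneg`: signs and comparison with
  the `δ = 0` objects (the normalising factor lies in `(0, 1]`).
* `IsDiPernaLionsApproximateSolution.continuousOn_truncatedDampingExponent_sharp`,
  `.hasDerivAt_truncatedDampingExponent_sharp`, `.truncatedDampingExponent_mono`: `Λ♯` is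
  continuous, nondecreasing, with `dΛ♯/ds = λ_δ♯` for `s > 0`.
* `eGain_mono`; `IsDiPernaLionsApproximateSolution.gainWith_eq_toReal_eGain_slice`,
  `.ofReal_truncatedGain_eq`: the Bochner gain term of a slice of an approximate solution is the
  (finite) true gain integral.
* `IsDiPernaLionsApproximateSolution.ofReal_sharp_eq_lintegral` ((3.36) in `[0,∞]`) and
  `.expSupersolution_of_le` ((3.38) for sub-densities and sub-kernels).

## References

* C. Cercignani, R. Illner, M. Pulvirenti, *The Mathematical Theory of Dilute Gases*, Springer
  (1994), §5.3 Step 13 ((3.36), p. 157) and proof of Lemma 5.3.12 ((3.38), p. 158).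
-/

open MeasureTheory Metric Real Set Filter Topology
open scoped InnerProductSpace ENNReal

noncomputable section

namespace Literature.MathematicalPhysics.KineticTheory

open Literature.Analysis.FluidPDE

variable {E : Type*} [NormedAddCommGroup E] [InnerProductSpace ℝ E] [FiniteDimensional ℝ E]
  [MeasurableSpace E] [BorelSpace E]

/-! ## Signs and comparisons of the truncated coefficients -/

section Coefficients

variable {δ : ℝ} {B : E × E → sphere (0 : E) 1 → ℝ} {f : ℝ → E → E → ℝ} {t : ℝ} {x : E}

/-- `λ_δ ≥ 0` for a nonnegative kernel, `δ ≥ 0` and a nonnegative slice. [folklore] -/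
theorem truncatedCollisionFrequency_nonneg (hB0 : ∀ p ω, 0 ≤ B p ω) (hδ : 0 ≤ δ)
    (hf0 : ∀ w, 0 ≤ f t x w) (v : E) : 0 ≤ truncatedCollisionFrequency δ B f t x v :=
  mul_nonneg (normalisingFactor_pos_and_le_one hδ _).1.le
    (DiPernaLionsMildLimitProofs.collisionFrequency_nonneg hB0 hf0 v)

/-- `G_δ ≥ 0` for a nonnegative kernel, `δ ≥ 0` and a nonnegative slice. [folklore] -/
theorem truncatedGain_nonneg (hB0 : ∀ p ω, 0 ≤ B p ω) (hδ : 0 ≤ δ) (hf0 : ∀ w, 0 ≤ f t x w)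
    (v : E) : 0 ≤ truncatedGain δ B f t x v :=
  mul_nonneg (normalisingFactor_pos_and_le_one hδ _).1.le (gainWith_nonneg hB0 hf0 v)

/-- `G_δ ≤ Q₊(f,f)` (the normalising factor is at most `1`). [folklore] -/
theorem truncatedGain_le_gainWith (hB0 : ∀ p ω, 0 ≤ B p ω) (hδ : 0 ≤ δ) (hf0 : ∀ w, 0 ≤ f t x w)
    (v : E) : truncatedGain δ B f t x v ≤ gainWith B (f t x) (f t x) v :=
  mul_le_of_le_one_left (gainWith_nonneg hB0 hf0 v) (normalisingFactor_pos_and_le_one hδ _).2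

/-- `λ_δ ≤ A ∗ f` (the normalising factor is at most `1`). [folklore] -/
theorem truncatedCollisionFrequency_le (hB0 : ∀ p ω, 0 ≤ B p ω) (hδ : 0 ≤ δ)
    (hf0 : ∀ w, 0 ≤ f t x w) (v : E) :
    truncatedCollisionFrequency δ B f t x v ≤ DiPernaLionsMildLimit.collisionFrequency B f t x v :=
  mul_le_of_le_one_left (DiPernaLionsMildLimitProofs.collisionFrequency_nonneg hB0 hf0 v)
    (normalisingFactor_pos_and_le_one hδ _).2

/-- `Λ♯(t) ≥ 0` for a density nonnegative at nonnegative times. [folklore] -/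
theorem truncatedDampingExponent_nonneg (hB0 : ∀ p ω, 0 ≤ B p ω) (hδ : 0 ≤ δ)
    (hf0 : ∀ t ≥ (0 : ℝ), ∀ x v, 0 ≤ f t x v) (t : ℝ) (x v : E) :
    0 ≤ truncatedDampingExponent δ B f t x v := by
  rw [truncatedDampingExponent_apply]
  exact setIntegral_nonneg measurableSet_Ioc fun s hs =>
    truncatedCollisionFrequency_nonneg hB0 hδ (fun w => hf0 s hs.1.le _ _) _

end Coefficients

/-! ## `Λ♯` along characteristics of an approximate solution -/

section Damping

variable {δ : ℝ} {B : E × E → sphere (0 : E) 1 → ℝ} {f : ℝ → E → E → ℝ}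

/-- **Continuity of `Λ♯` along a characteristic** on `[0, T]` (primitive of the continuous
`λ_δ♯`). [folklore] -/
theorem IsDiPernaLionsApproximateSolution.continuousOn_truncatedDampingExponent_sharp
    (hf : IsDiPernaLionsApproximateSolution δ B f) (hBm : Measurable (Function.uncurry B))
    (hB0 : ∀ p ω, 0 ≤ B p ω) {Cb : ℝ} (hCb : ∀ p ω, B p ω ≤ Cb) (hδ : 0 ≤ δ) (x v : E) {T : ℝ}
    (hT : 0 ≤ T) :
    ContinuousOn (fun s => truncatedDampingExponent δ B f s x v) (Icc 0 T) := by
  have hlam := hf.continuousOn_truncatedCollisionFrequency_sharp hBm hB0 hCb hδ x v hT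
  have h := intervalIntegral.continuousOn_primitive_interval (μ := volume)
    (f := fun s => truncatedCollisionFrequency δ B f s (x + s • v) v) (a := 0) (b := T)
    (by rw [uIcc_of_le hT]; exact hlam.integrableOn_Icc)
  rw [uIcc_of_le hT] at h
  refine h.congr fun s hs => ?_
  beta_reduce
  rw [truncatedDampingExponent_apply, intervalIntegral.integral_of_le hs.1]

/-- **`dΛ♯/ds = λ_δ♯`** at every `s > 0` along a characteristic of an approximate solution.
[folklore] -/
theorem IsDiPernaLionsApproximateSolution.hasDerivAt_truncatedDampingExponent_sharp
    (hf : IsDiPernaLionsApproximateSolution δ B f) (hBm : Measurable (Function.uncurry B))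
    (hB0 : ∀ p ω, 0 ≤ B p ω) {Cb : ℝ} (hCb : ∀ p ω, B p ω ≤ Cb) (hδ : 0 ≤ δ) (x v : E) {s : ℝ}
    (hs : 0 < s) :
    HasDerivAt (fun σ => truncatedDampingExponent δ B f σ x v)
      (truncatedCollisionFrequency δ B f s (x + s • v) v) s := by
  set lam : ℝ → ℝ := fun σ => truncatedCollisionFrequency δ B f σ (x + σ • v) v with hlam
  have hT : (0 : ℝ) ≤ s + 1 := by linarith
  have hlam_cont : ContinuousOn lam (Icc 0 (s + 1)) :=
    hf.continuousOn_truncatedCollisionFrequency_sharp hBm hB0 hCb hδ x v hT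
  have hs1 : s < s + 1 := by linarith
  have h1 : HasDerivAt (fun σ => ∫ τ in (0 : ℝ)..σ, lam τ) (lam s) s := by
    refine intervalIntegral.integral_hasDerivAt_right
      ((hlam_cont.mono (Icc_subset_Icc_right hs1.le)).intervalIntegrable_of_Icc hs.le) ?_
      (hlam_cont.continuousAt (Icc_mem_nhds hs hs1))
    exact (hlam_cont.mono Ioo_subset_Icc_self).stronglyMeasurableAtFilter isOpen_Ioo s ⟨hs, hs1⟩
  refine h1.congr_of_eventuallyEq ?_
  filter_upwards [Ioi_mem_nhds hs] with σ hσ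
  rw [truncatedDampingExponent_apply, intervalIntegral.integral_of_le (le_of_lt hσ)]

/-- **`Λ♯` is nondecreasing in time** on `[0, ∞)` along a characteristic of an approximate
solution with nonnegative kernel. [folklore] -/
theorem IsDiPernaLionsApproximateSolution.truncatedDampingExponent_mono
    (hf : IsDiPernaLionsApproximateSolution δ B f) (hBm : Measurable (Function.uncurry B))
    (hB0 : ∀ p ω, 0 ≤ B p ω) {Cb : ℝ} (hCb : ∀ p ω, B p ω ≤ Cb) (hδ : 0 ≤ δ) (x v : E) {s t : ℝ}
    (hs : 0 ≤ s) (hst : s ≤ t) :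
    truncatedDampingExponent δ B f s x v ≤ truncatedDampingExponent δ B f t x v := by
  have hlam_cont := hf.continuousOn_truncatedCollisionFrequency_sharp hBm hB0 hCb hδ x v (hs.trans hst)
  rw [truncatedDampingExponent_apply, truncatedDampingExponent_apply]
  refine setIntegral_mono_set ((hlam_cont.integrableOn_Icc).mono_set Ioc_subset_Icc_self) ?_
    (ae_of_all _ fun r hr => Ioc_subset_Ioc_right hst hr)
  filter_upwards [ae_restrict_mem measurableSet_Ioc] with r hr
  exact truncatedCollisionFrequency_nonneg hB0 hδ (fun w => hf.nonneg r hr.1.le _ _) _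

end Damping

/-! ## The true gain integral of a slice of an approximate solution -/

section Gain

variable {δ : ℝ} {B : E × E → sphere (0 : E) 1 → ℝ} {f : ℝ → E → E → ℝ}

/-- **Monotonicity of the true gain integral** in the kernel and in the density:
`0 ≤ b ≤ B`, `0 ≤ g ≤ f` (at the relevant slice) give `Q₊_b(g,g) ≤ Q₊_B(f,f)` in `[0, ∞]`.
[folklore] -/
theorem eGain_mono {b B : E × E → sphere (0 : E) 1 → ℝ} (hb0 : ∀ p ω, 0 ≤ b p ω)
    (hbB : ∀ p ω, b p ω ≤ B p ω) {g f : ℝ → E → E → ℝ} (p : ℝ × E × E)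
    (hg0 : ∀ w, 0 ≤ g p.1 p.2.1 w) (hgf : ∀ w, g p.1 p.2.1 w ≤ f p.1 p.2.1 w) :
    eGain b g p ≤ eGain B f p := by
  unfold eGain
  refine lintegral_mono fun q => ENNReal.ofReal_le_ofReal ?_
  exact mul_le_mul (hbB _ _) (mul_le_mul (hgf _) (hgf _) (hg0 _) ((hg0 _).trans (hgf _)))
    (mul_nonneg (hg0 _) (hg0 _)) ((hb0 _ _).trans (hbB _ _))

/-- For a slice `f(s, y, ·)`, `s ≥ 0`, of an approximate solution with a bounded DiPerna–Lions
kernel vanishing for large relative velocities, the true gain integral is finite and the Bochner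
gain term is its real part. [folklore] -/
theorem IsDiPernaLionsApproximateSolution.gainWith_eq_toReal_eGain_slice
    (hf : IsDiPernaLionsApproximateSolution δ B f) (hBk : IsDiPernaLionsKernel B) {Cb : ℝ}
    (hCb : ∀ p ω, B p ω ≤ Cb) {Rb : ℝ} (hRb : ∀ (z : E) ω, Rb ≤ ‖z‖ → B (z, 0) ω = 0) {s : ℝ}
    (hs : 0 ≤ s) (y v : E) :
    eGain B f (s, y, v) < ∞ ∧ gainWith B (f s y) (f s y) v = (eGain B f (s, y, v)).toReal := by
  obtain ⟨hc, ⟨K, hK⟩, hi⟩ := hf.slice_velocity hs y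
  have hgain := (gain_loss_integrable_of_bounded_kernel hBk hCb hRb hc hK hi v).1
  have hG0 : ∀ q : E × sphere (0 : E) 1, 0 ≤ B (v, q.1) q.2 *
      (f s y (collide q.2 (v, q.1)).1 * f s y (collide q.2 (v, q.1)).2) := fun q =>
    mul_nonneg (hBk.nonneg _ _) (mul_nonneg (hf.nonneg s hs _ _) (hf.nonneg s hs _ _))
  have hfin : eGain B f (s, y, v) < ∞ := by
    have h := hgain.hasFiniteIntegral
    rw [HasFiniteIntegral] at h
    refine lt_of_le_of_lt (le_of_eq ?_) h
    unfold eGain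
    exact lintegral_congr fun q => (Real.enorm_eq_ofReal (hG0 q)).symm
  have hGm : Measurable fun q : E × sphere (0 : E) 1 => B (v, q.1) q.2 *
      (f s y (collide q.2 (v, q.1)).1 * f s y (collide q.2 (v, q.1)).2) := by
    have hcol : Continuous fun q : E × sphere (0 : E) 1 => collide q.2 (v, q.1) :=
      continuous_collide_uncurry.comp ((continuous_const.prodMk continuous_fst).prodMk continuous_snd)
    exact (hBk.measurable.comp ((measurable_const.prodMk measurable_fst).prodMk measurable_snd)).mul
      ((hc.comp (continuous_fst.comp hcol)).mul (hc.comp (continuous_snd.comp hcol))).measurable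
  refine ⟨hfin, ?_⟩
  exact (integral_integral_eq_toReal_lintegral hGm hG0 hfin).2

/-- `ofReal (G_δ♯(s)) = ofReal (a♯(s)) · Q₊(f,f)♯(s)` in `[0, ∞]` for a slice `s ≥ 0` of an
approximate solution, `a = (1 + δ ∫ |f| dv)⁻¹`, with the true gain integral `eGain`. [folklore] -/
theorem IsDiPernaLionsApproximateSolution.ofReal_truncatedGain_eq
    (hf : IsDiPernaLionsApproximateSolution δ B f) (hBk : IsDiPernaLionsKernel B) {Cb : ℝ}
    (hCb : ∀ p ω, B p ω ≤ Cb) {Rb : ℝ} (hRb : ∀ (z : E) ω, Rb ≤ ‖z‖ → B (z, 0) ω = 0)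
    (hδ : 0 ≤ δ) {s : ℝ} (hs : 0 ≤ s) (y v : E) :
    ENNReal.ofReal (truncatedGain δ B f s y v) =
      ENNReal.ofReal ((1 + δ * ∫ w, |f s y w|)⁻¹) * eGain B f (s, y, v) := by
  obtain ⟨hfin, hgain⟩ := hf.gainWith_eq_toReal_eGain_slice hBk hCb hRb hs y v
  rw [truncatedGain, ENNReal.ofReal_mul (normalisingFactor_pos_and_le_one hδ _).1.le, hgain,
    ENNReal.ofReal_toReal hfin.ne]

end Gain

/-! ## The exponential form in `[0, ∞]` and the supersolution inequality (3.38) -/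

section Supersolution

variable {δ : ℝ} {B : E × E → sphere (0 : E) 1 → ℝ} {f : ℝ → E → E → ℝ}

/-- **The exponential form of an approximate solution in `[0, ∞]`** (CIP 1994 (3.36), rewritten
with the true gain integral): for `t ≥ 0` and every characteristic `(x, v)`,
`f♯(t) = f(0) e^{-Λ♯(t)} + ∫₀ᵗ a♯(s) Q₊(f,f)♯(s) e^{-(Λ♯(t) - Λ♯(s))} ds` in `[0, ∞]`,
`a = (1 + δ ∫ |f| dv)⁻¹`. [cite: CIPDiluteGases1994, §5.3 Step 13 (3.36) (p. 157)] -/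
theorem IsDiPernaLionsApproximateSolution.ofReal_sharp_eq_lintegral
    (hf : IsDiPernaLionsApproximateSolution δ B f) (hBk : IsDiPernaLionsKernel B) {Cb : ℝ}
    (hCb : ∀ p ω, B p ω ≤ Cb) {Rb : ℝ} (hRb : ∀ (z : E) ω, Rb ≤ ‖z‖ → B (z, 0) ω = 0)
    (hδ : 0 ≤ δ) (t : ℝ) (ht : 0 ≤ t) (x v : E) :
    ENNReal.ofReal (f t (x + t • v) v) =
      ENNReal.ofReal (f 0 x v * exp (-(truncatedDampingExponent δ B f t x v))) +
        ∫⁻ s in Ioc 0 t, ENNReal.ofReal ((1 + δ * ∫ w, |f s (x + s • v) w|)⁻¹) *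
          eGain B f (s, x + s • v, v) *
          ENNReal.ofReal (exp (-(truncatedDampingExponent δ B f t x v -
            truncatedDampingExponent δ B f s x v))) := by
  have hBm := hBk.measurable
  have hB0 := hBk.nonneg
  set Λ : ℝ → ℝ := fun s => truncatedDampingExponent δ B f s x v with hΛ
  set G : ℝ → ℝ := fun s => truncatedGain δ B f s (x + s • v) v with hG
  -- the real exponential form
  have hexp := hf.expForm hBk hCb hRb hδ t ht x v
  -- the Duhamel integrand is continuous, nonnegative, integrable on `(0, t]`
  have hΛc : ContinuousOn Λ (Icc 0 t) := hf.continuousOn_truncatedDampingExponent_sharp hBm hB0 hCb hδ x v ht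
  have hGe_cont : ContinuousOn (fun s => G s * exp (-(Λ t - Λ s))) (Icc 0 t) :=
    (hf.continuousOn_truncatedGain_sharp hBk hCb hRb hδ x v ht).mul
      (continuousOn_const.sub hΛc).neg.rexp
  have hint : IntegrableOn (fun s => G s * exp (-(Λ t - Λ s))) (Ioc 0 t) :=
    hGe_cont.integrableOn_Icc.mono_set Ioc_subset_Icc_self
  have hnn : 0 ≤ᵐ[volume.restrict (Ioc 0 t)] fun s => G s * exp (-(Λ t - Λ s)) := by
    filter_upwards [ae_restrict_mem measurableSet_Ioc] with s hs
    exact mul_nonneg (truncatedGain_nonneg hB0 hδ (fun w => hf.nonneg s hs.1.le _ _) _) (exp_pos _).le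
  have hD : ENNReal.ofReal (∫ s in Ioc 0 t, G s * exp (-(Λ t - Λ s))) =
      ∫⁻ s in Ioc 0 t, ENNReal.ofReal (G s * exp (-(Λ t - Λ s))) :=
    ofReal_integral_eq_lintegral_ofReal hint hnn
  have hA : 0 ≤ f 0 x v * exp (-(Λ t)) := mul_nonneg (hf.nonneg 0 le_rfl _ _) (exp_pos _).le
  have hDnn : 0 ≤ ∫ s in Ioc 0 t, G s * exp (-(Λ t - Λ s)) := integral_nonneg_of_ae hnn
  change ENNReal.ofReal (f t (x + t • v) v) = ENNReal.ofReal (f 0 x v * exp (-(Λ t))) +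
    ∫⁻ s in Ioc 0 t, ENNReal.ofReal ((1 + δ * ∫ w, |f s (x + s • v) w|)⁻¹) *
      eGain B f (s, x + s • v, v) * ENNReal.ofReal (exp (-(Λ t - Λ s)))
  rw [hexp, ENNReal.ofReal_add hA hDnn, hD]
  congr 1
  refine setLIntegral_congr_fun measurableSet_Ioc fun s hs => ?_
  rw [ENNReal.ofReal_mul' (exp_pos _).le, hf.ofReal_truncatedGain_eq hBk hCb hRb hδ hs.1.le]

/-- **The supersolution inequality (3.38) for sub-densities and sub-kernels** (CIP 1994 §5.3,
proof of Lemma 5.3.12, p. 158: "Now observe that from (3.36)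
`fⁿ ≥ f₀ⁿ e^{-Fₙ} + T_{Fₙ}⁻¹ Q₊ⁿ(gₘⁿ, gₘⁿ)` (3.38)", printed for `gₘⁿ = fⁿ ∧ m`). For an
approximate solution `f` with a bounded DiPerna–Lions kernel `B` vanishing for large relative
velocities, `δ ≥ 0`, every kernel `0 ≤ b ≤ B` and every density `0 ≤ g ≤ f` on `[0,∞) × E × E`:
for `t ≥ 0` and every characteristic `(x, v)`,
`f(0) e^{-Λ♯(t)} + ∫₀ᵗ a♯(s) Q₊_b(g,g)♯(s) e^{-(Λ♯(t) - Λ♯(s))} ds ≤ f♯(t)` in `[0, ∞]`, where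
the damping `Λ♯`, `a = (1 + δ ∫ |f| dv)⁻¹` are those of `f` and `Q₊_b(g,g)` is the true gain
integral `eGain b g` (monotonicity of the gain term in the kernel and the density). [cite: CIPDiluteGases1994, §5.3 Lemma 5.3.12, proof, (3.38) (p. 158)] -/
theorem IsDiPernaLionsApproximateSolution.expSupersolution_of_le
    (hf : IsDiPernaLionsApproximateSolution δ B f) (hBk : IsDiPernaLionsKernel B) {Cb : ℝ}
    (hCb : ∀ p ω, B p ω ≤ Cb) {Rb : ℝ} (hRb : ∀ (z : E) ω, Rb ≤ ‖z‖ → B (z, 0) ω = 0)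
    (hδ : 0 ≤ δ) {b : E × E → sphere (0 : E) 1 → ℝ} (hb0 : ∀ p ω, 0 ≤ b p ω)
    (hbB : ∀ p ω, b p ω ≤ B p ω) {g : ℝ → E → E → ℝ} (hg0 : ∀ s ≥ (0 : ℝ), ∀ y w, 0 ≤ g s y w)
    (hgf : ∀ s ≥ (0 : ℝ), ∀ y w, g s y w ≤ f s y w) (t : ℝ) (ht : 0 ≤ t) (x v : E) :
    ENNReal.ofReal (f 0 x v * exp (-(truncatedDampingExponent δ B f t x v))) +
        ∫⁻ s in Ioc 0 t, ENNReal.ofReal ((1 + δ * ∫ w, |f s (x + s • v) w|)⁻¹) *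
          eGain b g (s, x + s • v, v) *
          ENNReal.ofReal (exp (-(truncatedDampingExponent δ B f t x v -
            truncatedDampingExponent δ B f s x v))) ≤
      ENNReal.ofReal (f t (x + t • v) v) := by
  rw [hf.ofReal_sharp_eq_lintegral hBk hCb hRb hδ t ht x v]
  refine add_le_add le_rfl (lintegral_mono_ae ?_)
  filter_upwards [ae_restrict_mem measurableSet_Ioc] with s hs
  refine mul_le_mul_left (mul_le_mul_right ?_ _) _
  exact eGain_mono hb0 hbB (s, x + s • v, v) (fun w => hg0 s hs.1.le _ _) (fun w => hgf s hs.1.le _ _)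

end Supersolution

end Literature.MathematicalPhysics.KineticTheory
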